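import Summits.HodgeConjecture.HodgeConjecture.Theorems.Ring2HypothesesDescent
import Summits.HodgeConjecture.HodgeConjecture.Theorems.Ring2AbelianAllAndreLiebermanHolds
import Summits.HodgeConjecture.HodgeConjecture.Theorems.EndoscopicMiddleDegreeCupProductAlgebraic
import Literature.AlgebraicGeometry.HodgeTheory.MotivatedClassesProofs
import Literature.AlgebraicGeometry.HodgeTheory.MotivatedClassesAlgebraic
import Literature.AlgebraicGeometry.HodgeTheory.HardLefschetzNFoldHolds
import Literature.AlgebraicGeometry.Motives.AbelianVarietyProductDimProofs
import HarnessLib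

/-!
# Ring 2 — hypotheses layer, descent axis: row b05 and ANDRÉ'S §6.2 — motivated classes on abelian varieties
# MODELLED ON ABELIAN PIECES are algebraic (kernel theorem, no hypothesis), so row b05 is exactly the passage
# from André's pieces `B × Y₁ × ⋯ × Y_k` (compact abelian pencils, §6.3) to abelian pieces

HONEST FRAMING (page 1, verbatim the cell's standing line): **research route conditional on HC_CM; not a
corollary; Q11.4-sentence-2 already refuted in dim ≥ 3.** Nothing in this file proves a case of the Hodge
conjecture; no node of BINDER-OWNERS.md is discharged («10 · 0» untouched); `HC_CM` (by name
`Theses.RankFourFaces.CMAbelianHodge`) occurs once, as a CONSEQUENCE (§4). Seat `pub-hodge-ring2-b05`, gen 31,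
row b05 `Ring2.Hypotheses.MotivatedImpliesAlgebraicAV` (`Ring2HypothesesDescent.lean` :177). New tree tool used:
sub-cell AbelianAll part XXII-c (`Ring2AbelianAllAndreLiebermanHolds.lean`, 2026-08-21): Lieberman's `B(A)` for every
complex abelian variety is a THEOREM of the tree (`AbelianAll.standardConjectureBStar_abelianVariety`).

## Source (André 1996, §6, verbatim) and what is proved

André, *Pour une théorie inconditionnelle des motifs*, §0.3 / §2.1: the motivated cycles are "modelés sur `𝒱`",
`𝒱` a full subcategory of smooth projective schemes stable under products ("pièces de base"); §6.1: `𝒜b` = the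
schemes `A ×_K K'`, `A` an abelian variety; **§6.2 (p. 31): "Le cas `Ob 𝒱 = 𝒜b` : dans ce cas, on sait que quelle
que soit la classe du faisceau inversible ample choisie, les opérateurs `ᵖπ`, `*_L` et `*_H` sont donnés par des
correspondances algébriques indépendantes de la cohomologie [L68], Th. 1 et 3 (cf. aussi [Kl68], app.). Donc les
cycles motivés modelés sur `𝒜b` sont algébriques."** §6.3 (p. 31): "Le cas où `K = ℂ` et `𝒱` contient les pinceaux
compacts de variétés abéliennes" — there Thm. 0.6.2 (every Hodge cycle on `A` is `Σ p_*(α ∪ *_L β)` with `α, β`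
algebraic on `A × B × Y₁ × ⋯ × Y_k`, `B` abelian, `Yᵢ` total spaces of compact abelian pencils) and Remarque 2
(p. 33): HC for abelian varieties ⟸ `*_L` algebraic on the compact abelian pencils = row b05's `X`.

On the real carriers of the tree (`HodgeTheory.IsMotivatedClass n X p`: generators `pr_{X*}(α ∪ *_L β)`, `α, β`
algebraic on `X ⊗ Y`, `Y` the auxiliary piece, `η` any polarisation class of `X ⊗ Y`):

* §1 `gysinMap_cupProduct_lefschetzInvolution_mem_algebraicClasses_of_standardConjectureBStar` — André's §2.1
  remark LOCALISED to one generator: `B(X ⊗ Y)` for the polarisation used ⟹ the generator is algebraic (no other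
  hypothesis: the multiplicativity of algebraic classes is the tree's `Theorems.Voisin2003_cupProduct_algebraicClasses_holds`);
  `motivatedClasses_le_algebraicClasses_of_standardConjectureBStar_tensor` — `A_motᵖ(X) ⊆ A(X)` ⟸ `B(X × Y)` for
  all pieces `Y` (per-`X` sharpening of the fact `Andre1996_motivatedClasses_le_algebraicClasses_of_standardConjectureB`,
  which asks `B(Z)` for ALL `Z`); `motivatedImpliesAlgebraicAV_of_standardConjectureBStar_abelian_tensor` — row b05
  ⟸ `B(A × Y)` for all abelian `A` and all pieces `Y` (weaker input than row b10 `B(all)`).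
* §2 **André §6.2 as a kernel theorem**: `gysinMap_cupProduct_lefschetzInvolution_mem_algebraicClasses_abelianPiece` —
  a generator on the abelian variety `A` whose piece is an abelian variety `B` is ALGEBRAIC, for every polarisation
  class of `A × B` (`B(A × B)` by Lieberman, `A × B` being an abelian variety: `AbelianVariety.prod`, `dim_prod`);
  `abelianPiece_of_mem_algebraicClasses` — conversely every algebraic class is such a generator (`B := A`, the
  diagonal construction of `HodgeTheory.isMotivatedClass_of_mem_algebraicClasses`, polarisation of `A × A` from the
  tree's hard Lefschetz theorem `nonempty_hardLefschetzNFold_holds`);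
  **`span_abelianPieces_eq_algebraicClasses` : `A_motᵖ(A)^{𝒜b}_ℂ = Nᵖ H²ᵖ(A(ℂ); ℂ)`** for every complex abelian
  variety `A` and every `p` — "les cycles motivés modelés sur `𝒜b` sont algébriques", with "il est clair que
  `A_mot ⊇ A`". Pieces `B × K'` (`K'` a finite `ℂ`-algebra = points) and products `B₁ × ⋯ × B_r` are abelian
  varieties (`AbelianVariety.trivial`, `AbelianVariety.prod`), so one abelian piece is André's whole `𝒜b` over `ℂ`.
* §3 Row b05 and `HC_AV` in the words of §6: `motivatedImpliesAlgebraicAV_iff_motivatedClasses_le_span_abelianPieces`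
  — **row b05 ⟺ on abelian varieties every motivated class (all pieces) is motivated by abelian pieces**;
  `hc_av_iff_hodgeClasses_le_span_abelianPieces` — **`HC_AV` ⟺ Thm. 0.6.2 with `𝒱 = 𝒜b`** (every rational
  `(p,p)`-class on every complex abelian variety is a sum of `pr_{A*}(α ∪ *_L β)` with ABELIAN pieces). By §2 both
  right-hand sides are unfoldings of "… is algebraic": the content of §3 is the juxtaposition with the tree fact
  `Andre1996_hodgeClasses_abelianVariety_motivated` (c2; pieces = compact abelian pencils, §6.3), nothing more.
* §4 the ladder edge, by name only: `hc_cm_of_hodgeClasses_le_span_abelianPieces`.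
HONEST COLUMN. Nothing is discharged: row b05 stays OPEN «published modulo X», X = `B` on the compact abelian
pencils (`Ring2.AbelianAll.CompactAbelianPencilLefschetz`); the total space of a non-isotrivial compact abelian
pencil is NOT an abelian variety, so §2 says nothing about X. Not claimed: any statement about André's finer
pieces `A × B × Y₁ × ⋯ × Y_k` (the tree types Thm. 0.6.2 with `𝒱` = all pieces only); `B` for any non-abelian
variety; independence of `*_L` of the cohomology theory ([L68] Th. 3). EDGE LABELS: all K (kernel), fact-free;
axiom closures standard (bottom of file). Count once: Lieberman's theorem is ab-andre-2's (XXII-a–c).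

References (bib keys): Andre1996Motifs (§0.3 p. 7, §2.1 Déf. 1 p. 14, §6.1–6.3 pp. 30–33, Thm. 0.6.2 p. 9), Lieberman1968
(Th. 1, 3), Kleiman1968AlgebraicCycles (App. to §2, 2A11), VoisinHodgeII2003 (Prop. 9.20–9.21), FultonYoungTableaux1997 (App. B).
-/

set_option linter.dupNamespace false -- `HodgeConjecture.HodgeConjecture` in the module path, as in every `Ring2Hypotheses*` file

noncomputable section

open CategoryTheory AlgebraicGeometry MonoidalCategory CartesianMonoidalCategory
open Literature.AlgebraicTopology.SingularHomology Literature.Geometry.Kaehler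
open Literature.AlgebraicGeometry Literature.AlgebraicGeometry.Motives
open Literature.AlgebraicGeometry.HodgeTheory

namespace Summit.HodgeConjecture.HodgeConjecture.Ring2.Hypotheses

/-! ## §1 André's §2.1 remark, one generator at a time: `B(X × Y)` for the piece used suffices -/

section Local

variable {n m : ℕ} {X Y : SchemeOver ℂ}

/-- **`B(X × Y)` ⟹ the generator `pr_{X*}(α ∪ *_L β)` with piece `Y` is algebraic** (André 1996, §2.1, remark
following Déf. 1, p. 14, localised: "`A_mot(X) = A(X)` si pour tout schéma `Y` dans `𝒱`, polarisé, l'involution de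
Lefschetz est donnée par une correspondance algébrique" — the printed argument uses `B` only for the polarised
`X × Y` at hand). For `X`, `Y` smooth projective of dimensions `n`, `m`, a polarisation class `η` of `X ⊗ Y` whose
Lefschetz involution is induced by algebraic correspondences (`StandardConjectureBStar (n + m) (X ⊗ Y) η`), and
algebraic `α ∈ Nᵃ`, `β ∈ Nᵇ` on `X ⊗ Y` (`b + b' = n + m`, `a + b' = p + m`, `p + q = n`): `*_L β = γ^* β` is
algebraic (`corrClassAction_mem_algebraicClasses_of_cupProduct`), so is `α ∪ *_L β` (multiplicativity of
algebraic classes, the tree's theorem `Theorems.Voisin2003_cupProduct_algebraicClasses_holds`) and its Gysin image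
(`gysinMap_mem_supportedClasses_of_isSmoothProjective`). No named fact is consumed.
[cite: Andre1996Motifs, §2.1 remark following Déf. 1 (p. 14)] [cite: VoisinHodgeII2003, Prop. 9.20 and Prop. 9.21] -/
theorem gysinMap_cupProduct_lefschetzInvolution_mem_algebraicClasses_of_standardConjectureBStar
    (hX : IsSmoothProjective n X) (hY : IsSmoothProjective m Y)
    (μ : HomologicalOrientation ℂ (ComplexPoints (X ⊗ Y)) (2 * (n + m)))
    (ν : HomologicalOrientation ℂ (ComplexPoints X) (2 * n)) (hν : ν.HasPoincareDuality)
    {η : complexBetti (X ⊗ Y) 2} (hη : IsPolarizationClass (n + m) (X ⊗ Y) η)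
    (hB : StandardConjectureBStar (n + m) (X ⊗ Y) η)
    {p a b b' q : ℕ} (hbb' : b + b' = n + m) (hab : a + b' = p + m) (hq : p + q = n)
    {α : complexBetti (X ⊗ Y) (2 * a)} {β : complexBetti (X ⊗ Y) (2 * b)}
    (hα : α ∈ algebraicClasses (X ⊗ Y) a) (hβ : β ∈ algebraicClasses (X ⊗ Y) b) :
    gysinMap μ ν (AlgPoints.mapContinuous (L := ℂ) (fst X Y))
        (show 2 * (p + m) + 2 * q = 2 * (n + m) by omega) (show 2 * p + 2 * q = 2 * n by omega)
        (cupProduct (show 2 * a + 2 * b' = 2 * (p + m) by omega) α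
          (lefschetzInvolution hη.hasHardLefschetz (show 2 * b + 2 * b' = 2 * (n + m) by omega) β)) ∈
      algebraicClasses X p := by
  have hXY : IsSmoothProjective (n + m) (X ⊗ Y) := IsSmoothProjective.tensor_holds hX hY
  have hcup := Theorems.Voisin2003_cupProduct_algebraicClasses_holds
  have h2d : 2 * b + 2 * b' = 2 * (n + m) := by omega
  -- (B): `*_L = γ^*` on `H^{2b}((X ⊗ Y)(ℂ))` for an algebraic `γ` on `(X ⊗ Y) ⊗ (X ⊗ Y)`
  obtain ⟨μ', ν', -, hν', e, k, hab', hk, γ, hγ, hγL⟩ := hB hη (2 * b) (2 * b') h2d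
  -- `*_L β = γ^* β` is algebraic of codimension `b'`
  have hLβ : lefschetzInvolution hη.hasHardLefschetz h2d β ∈ algebraicClasses (X ⊗ Y) b' := by
    have h := corrClassAction_mem_algebraicClasses_of_cupProduct hXY hXY μ' ν' hν' hab' hk
      (fun x y hx hy ↦ hcup (IsSmoothProjective.tensor_holds hXY hXY) hx hy) hγ hβ
    rwa [hγL] at h
  -- `α ∪ *_L β ∈ N^{a+b'} = N^{p+m}`, and `pr_{X*}` lowers the codimension by `m`
  refine gysinMap_mem_supportedClasses_of_isSmoothProjective hXY hX μ ν hν (fst X Y) _ _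
    (r := p + m) (by omega) ?_
  exact (cupProduct_mem_supportedClasses_congr (two_mul_add_two_mul a b') _ hab α _).mp
    (hcup hXY hα hLβ)

/-- **`A_motᵖ(X)_ℂ ⊆ Nᵖ H²ᵖ(X(ℂ); ℂ)` as soon as `B(X × Y)` holds for every piece `Y`** (and every polarisation
class of `X ⊗ Y`): the per-`X` form of André's §2.1 remark — the tree's named fact
`Andre1996_motivatedClasses_le_algebraicClasses_of_standardConjectureB` asks `B(Z)` for ALL smooth projective `Z`,
the proof only ever uses it for the products `X × Y`. [cite: Andre1996Motifs, §2.1 remark following Déf. 1 (p. 14)] -/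
theorem motivatedClasses_le_algebraicClasses_of_standardConjectureBStar_tensor (hX : IsSmoothProjective n X)
    (hB : ∀ (m : ℕ) (Y : SchemeOver ℂ) (η : complexBetti (X ⊗ Y) 2), IsSmoothProjective m Y →
      StandardConjectureBStar (n + m) (X ⊗ Y) η) (p : ℕ) :
    motivatedClasses n X p ≤ algebraicClasses X p := by
  rw [motivatedClasses_le_iff]
  rintro x ⟨m, Y, hY, μ, ν, -, hν, η, hη, a, b, b', q, hbb', hab, hq, α, β, hα, hβ, rfl⟩
  exact gysinMap_cupProduct_lefschetzInvolution_mem_algebraicClasses_of_standardConjectureBStar hX hY μ ν hν hη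
    (hB m Y η hY) hbb' hab hq hα hβ

end Local

/-- **Row b05 ⟸ `B(A × Y)` for every complex abelian variety `A` and every piece `Y`** (all smooth projective
`Y`, all polarisation classes of `A ⊗ Y`) — a weaker input than row b10's `B(all)` (the products `A × Y` only) and
a different one from row b05's `X` (`B` on the compact abelian pencils, which reaches b05 through André's Thm.
0.6.2 and `HC_AV`). Fact-free. [cite: Andre1996Motifs, §2.1 remark following Déf. 1 (p. 14)] -/
theorem motivatedImpliesAlgebraicAV_of_standardConjectureBStar_abelian_tensor
    (hB : ∀ (A : AbelianVariety ℂ) (m : ℕ) (Y : SchemeOver ℂ) (η : complexBetti (A.X ⊗ Y) 2),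
      IsSmoothProjective m Y → StandardConjectureBStar (A.dim + m) (A.X ⊗ Y) η) :
    MotivatedImpliesAlgebraicAV :=
  fun A p ↦ motivatedClasses_le_algebraicClasses_of_standardConjectureBStar_tensor
    (AbelianVariety.isSmoothProjective_holds (A := A)) (hB A) p

/-! ## §2 André §6.2: motivated classes modelled on abelian pieces are algebraic — and conversely -/

/-- **André 1996, §6.2 — a motivated generator on an abelian variety whose piece is an abelian variety is
ALGEBRAIC** ("Le cas `Ob 𝒱 = 𝒜b` : […] les opérateurs `ᵖπ`, `*_L` et `*_H` sont donnés par des correspondances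
algébriques […] [L68], Th. 1 et 3 (cf. aussi [Kl68], app.). Donc les cycles motivés modelés sur `𝒜b` sont
algébriques."), on the real carriers and WITHOUT HYPOTHESES: for complex abelian varieties `A`, `B`, any
polarisation class `η` of `A ⊗ B` (= the abelian variety `A × B`, `AbelianVariety.prod`, of dimension
`dim A + dim B`, `AbelianVariety.dim_prod`), `ℂ`-orientations `μ`, `ν` (`ν` with Poincaré duality) and algebraic
`α ∈ Nᵃ`, `β ∈ Nᵇ` on `A ⊗ B`, the class `pr_{A*}(α ∪ *_L β) ∈ H²ᵖ(A(ℂ); ℂ)` is algebraic — §1 with `B(A × B)`,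
which is Lieberman's theorem, a theorem of the tree (`AbelianAll.standardConjectureBStar_abelianVariety`, part
XXII-c of the AbelianAll sub-cell). [cite: Andre1996Motifs, §6.2 (p. 31)] [cite: Lieberman1968, Th. 1 and Th. 3]
[cite: Kleiman1968AlgebraicCycles, Appendix to §2, Thm. 2A11] -/
theorem gysinMap_cupProduct_lefschetzInvolution_mem_algebraicClasses_abelianPiece (A B : AbelianVariety ℂ)
    (μ : HomologicalOrientation ℂ (ComplexPoints (A.X ⊗ B.X)) (2 * (A.dim + B.dim)))
    (ν : HomologicalOrientation ℂ (ComplexPoints A.X) (2 * A.dim)) (hν : ν.HasPoincareDuality)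
    {η : complexBetti (A.X ⊗ B.X) 2} (hη : IsPolarizationClass (A.dim + B.dim) (A.X ⊗ B.X) η)
    {p a b b' q : ℕ} (hbb' : b + b' = A.dim + B.dim) (hab : a + b' = p + B.dim) (hq : p + q = A.dim)
    {α : complexBetti (A.X ⊗ B.X) (2 * a)} {β : complexBetti (A.X ⊗ B.X) (2 * b)}
    (hα : α ∈ algebraicClasses (A.X ⊗ B.X) a) (hβ : β ∈ algebraicClasses (A.X ⊗ B.X) b) :
    gysinMap μ ν (AlgPoints.mapContinuous (L := ℂ) (fst A.X B.X))
        (show 2 * (p + B.dim) + 2 * q = 2 * (A.dim + B.dim) by omega) (show 2 * p + 2 * q = 2 * A.dim by omega)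
        (cupProduct (show 2 * a + 2 * b' = 2 * (p + B.dim) by omega) α
          (lefschetzInvolution hη.hasHardLefschetz (show 2 * b + 2 * b' = 2 * (A.dim + B.dim) by omega) β)) ∈
      algebraicClasses A.X p := by
  -- `B(A × B)`: Lieberman, for the abelian variety `A.prod B` (`(A.prod B).X = A.X ⊗ B.X` by construction)
  have hB : StandardConjectureBStar (A.dim + B.dim) (A.X ⊗ B.X) η := by
    rw [← AbelianVariety.dim_prod]
    exact AbelianAll.standardConjectureBStar_abelianVariety (A.prod B) η
  exact gysinMap_cupProduct_lefschetzInvolution_mem_algebraicClasses_of_standardConjectureBStar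
    (AbelianVariety.isSmoothProjective_holds (A := A)) (AbelianVariety.isSmoothProjective_holds (A := B))
    μ ν hν hη hB hbb' hab hq hα hβ

/-- **Conversely, every algebraic class on `A` is a generator with an abelian piece** (André 1996, §2.1, "il est
clair que `A_mot(X)_E` contient `A(X)`", with the piece `Y := A` itself): for `p ≤ dim A` and
`c ∈ Nᵖ H²ᵖ(A(ℂ); ℂ)`, `c = pr_{1*}(pr₁^* c ∪ *_L Δ_* 1)` with `Δ_* 1 ∈ N^{dim A}` the class of the diagonal of
`A × A` and `*_L = id` in the middle degree — the construction of the tree's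
`HodgeTheory.isMotivatedClass_of_mem_algebraicClasses` (there the piece is hidden in `∃ Y`; here it is recorded),
the polarisation class of `A × A` being supplied by the hard Lefschetz theorem (`nonempty_hardLefschetzNFold_holds`).
[cite: Andre1996Motifs, §2.1 remark following Déf. 1 (p. 14)]
[cite: FultonYoungTableaux1997, Appendix B §B.1 (2), (5), (6) and §B.2 Exercise 5] -/
theorem abelianPiece_of_mem_algebraicClasses (A : AbelianVariety ℂ) {p : ℕ} (hp : p ≤ A.dim)
    {c : complexBetti A.X (2 * p)} (hc : c ∈ algebraicClasses A.X p) :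
    ∃ (B : AbelianVariety ℂ)
      (μ : HomologicalOrientation ℂ (ComplexPoints (A.X ⊗ B.X)) (2 * (A.dim + B.dim)))
      (ν : HomologicalOrientation ℂ (ComplexPoints A.X) (2 * A.dim))
      (_ : μ.HasPoincareDuality) (_ : ν.HasPoincareDuality)
      (η : complexBetti (A.X ⊗ B.X) 2) (hη : IsPolarizationClass (A.dim + B.dim) (A.X ⊗ B.X) η)
      (a b b' q : ℕ) (_ : b + b' = A.dim + B.dim) (_ : a + b' = p + B.dim) (_ : p + q = A.dim)
      (α : complexBetti (A.X ⊗ B.X) (2 * a)) (β : complexBetti (A.X ⊗ B.X) (2 * b)),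
      α ∈ algebraicClasses (A.X ⊗ B.X) a ∧ β ∈ algebraicClasses (A.X ⊗ B.X) b ∧
        c = gysinMap μ ν (AlgPoints.mapContinuous (L := ℂ) (fst A.X B.X))
              (show 2 * (p + B.dim) + 2 * q = 2 * (A.dim + B.dim) by omega)
              (show 2 * p + 2 * q = 2 * A.dim by omega)
              (cupProduct (show 2 * a + 2 * b' = 2 * (p + B.dim) by omega) α
                (lefschetzInvolution hη.hasHardLefschetz
                  (show 2 * b + 2 * b' = 2 * (A.dim + B.dim) by omega) β)) := by
  -- adapted from `HodgeTheory.isMotivatedClass_of_mem_algebraicClasses` (MotivatedClassesAlgebraic), `Y := A.X`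
  classical
  have hX : IsSmoothProjective A.dim A.X := AbelianVariety.isSmoothProjective_holds (A := A)
  have hXX : IsSmoothProjective (A.dim + A.dim) (A.X ⊗ A.X) := IsSmoothProjective.tensor_holds hX hX
  -- a polarisation class of `A × A`: the hard Lefschetz theorem
  obtain ⟨Λ⟩ := nonempty_hardLefschetzNFold_holds (A.dim + A.dim) (A.X ⊗ A.X) hXX
  -- the diagonal, a section of `pr₁`
  obtain ⟨Δ, hΔfst⟩ : ∃ Δ : A.X ⟶ A.X ⊗ A.X, Δ ≫ fst A.X A.X = 𝟙 A.X := ⟨lift (𝟙 _) (𝟙 _), lift_fst _ _⟩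
  -- `ℂ`-orientations of all `Z(ℂ)`, `Z` smooth projective, with Poincaré duality
  obtain ⟨μ, hμ⟩ : ∃ μ : OrientationFamily, μ.HasPoincareDuality :=
    ⟨fun _ _ h ↦ Classical.choice (ComplexPoints.isOrientableOver ℂ h), OrientationFamily.hasPoincareDuality _⟩
  -- `β = Δ_* 1`, an algebraic class of codimension `dim A` on `A ⊗ A`
  have hΔ : 0 + 2 * (A.dim + A.dim) = 2 * A.dim + 2 * A.dim := by omega
  obtain ⟨β, hβdef⟩ : ∃ β : complexBetti (A.X ⊗ A.X) (2 * A.dim),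
      β = complexGysin μ hX hXX Δ hΔ (singularCohomology.one ℂ (ComplexPoints A.X)) := ⟨_, rfl⟩
  have hΔcl : IsClosedMap Δ.left.base :=
    haveI := isProper_left_of_isSmoothProjective hX hXX Δ
    Δ.left.isClosedMap
  have hβ : β ∈ algebraicClasses (A.X ⊗ A.X) A.dim := by
    rw [hβdef]
    refine mem_supportedClasses_of_restrictCompl_eq_zero hΔcl.isClosed_range (fun z hz ↦ ?_) ?_
    · rw [← Set.image_univ] at hz
      exact le_coheight_of_mem_image hX hXX Δ hΔcl (S := Set.univ) (r := 0) (s := A.dim)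
        (fun _ _ ↦ by simp) (by omega) hz
    · exact restrictCompl_complexGysin_eq_zero (gysinMap_restrictCompl_eq_zero_of_field ℂ) μ hμ hXX
        hX Δ hΔcl.isClosed_range subset_rfl hΔ _
  -- `α = pr₁^* c`, an algebraic class of codimension `p` on `A ⊗ A`
  have hα : complexBetti.map (fst A.X A.X) (2 * p) c ∈ algebraicClasses (A.X ⊗ A.X) p :=
    map_fst_mem_supportedClasses hX hX hc
  refine ⟨A, μ hXX, μ hX, hμ hXX, hμ hX, Λ.hyperplaneClass, Λ.isPolarizationClass, p, A.dim, A.dim,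
    A.dim - p, rfl, rfl, by omega, complexBetti.map (fst A.X A.X) (2 * p) c, β, hα, hβ, ?_⟩
  -- `*_L β = β` in the middle degree `2 dim A`
  have hstar : ∀ h4 : 2 * A.dim + 2 * A.dim = 2 * (A.dim + A.dim),
      lefschetzInvolution Λ.isPolarizationClass.hasHardLefschetz h4 β = β := by
    intro h4
    have h := lefschetzInvolution_apply_of_le Λ.isPolarizationClass.hasHardLefschetz (a := 2 * A.dim) (j := 0)
      (by omega) h4 β
    rw [lefschetzPow_zero, LinearMap.id_apply] at h
    exact h
  rw [hstar]
  -- `pr_{1*}` as the Gysin morphism of the orientation family, and the projection formula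
  rw [← complexGysin_eq_gysinMap hXX hX (fst A.X A.X)
    (show 2 * (p + A.dim) + 2 * A.dim = 2 * p + 2 * (A.dim + A.dim) by omega)]
  rw [complexGysin_cup hμ hXX hX (fst A.X A.X) _ _ (show 2 * A.dim + 2 * A.dim = 0 + 2 * (A.dim + A.dim) by omega)
    (Nat.add_zero _)]
  -- `pr_{1*} Δ_* 1 = (Δ ≫ pr₁)_* 1 = 𝟙_* 1 = 1`
  have hcomp := complexGysin_comp hμ hX hXX hX Δ (fst A.X A.X) hΔ
    (show 2 * A.dim + 2 * A.dim = 0 + 2 * (A.dim + A.dim) by omega)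
  rw [hΔfst, complexGysin_id hμ hX 0] at hcomp
  have h1 : complexGysin μ hXX hX (fst A.X A.X) (show 2 * A.dim + 2 * A.dim = 0 + 2 * (A.dim + A.dim) by omega) β =
      singularCohomology.one ℂ (ComplexPoints A.X) := by
    have h := LinearMap.congr_fun hcomp (singularCohomology.one ℂ (ComplexPoints A.X))
    rw [LinearMap.comp_apply, LinearMap.id_apply, ← hβdef] at h
    exact h.symm
  rw [h1, cupProduct_one]

/-- **André 1996, §6.2 in subspace form: `A_motᵖ(A)^{𝒜b}_ℂ = Nᵖ H²ᵖ(A(ℂ); ℂ)`** — for every complex abelian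
variety `A` and every `p`, the `ℂ`-span of the motivated generators `pr_{A*}(α ∪ *_L β)` WITH ABELIAN PIECES
(`α`, `β` algebraic on `A ⊗ B`, `B` an abelian variety, `η` any polarisation class of `A ⊗ B`) is exactly the
space of algebraic classes: `⊆` is §6.2 ("les cycles motivés modelés sur `𝒜b` sont algébriques", via Lieberman),
`⊇` is §2.1 ("il est clair", piece `A`; above the top degree both sides are `0`). No hypothesis.
[cite: Andre1996Motifs, §6.2 (p. 31) and §2.1 remark following Déf. 1 (p. 14)] [cite: Lieberman1968, Th. 1 and Th. 3] -/
theorem span_abelianPieces_eq_algebraicClasses (A : AbelianVariety ℂ) (p : ℕ) :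
    Submodule.span ℂ {x : complexBetti A.X (2 * p) | ∃ (B : AbelianVariety ℂ)
      (μ : HomologicalOrientation ℂ (ComplexPoints (A.X ⊗ B.X)) (2 * (A.dim + B.dim)))
      (ν : HomologicalOrientation ℂ (ComplexPoints A.X) (2 * A.dim))
      (_ : μ.HasPoincareDuality) (_ : ν.HasPoincareDuality)
      (η : complexBetti (A.X ⊗ B.X) 2) (hη : IsPolarizationClass (A.dim + B.dim) (A.X ⊗ B.X) η)
      (a b b' q : ℕ) (_ : b + b' = A.dim + B.dim) (_ : a + b' = p + B.dim) (_ : p + q = A.dim)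
      (α : complexBetti (A.X ⊗ B.X) (2 * a)) (β : complexBetti (A.X ⊗ B.X) (2 * b)),
      α ∈ algebraicClasses (A.X ⊗ B.X) a ∧ β ∈ algebraicClasses (A.X ⊗ B.X) b ∧
        x = gysinMap μ ν (AlgPoints.mapContinuous (L := ℂ) (fst A.X B.X))
              (show 2 * (p + B.dim) + 2 * q = 2 * (A.dim + B.dim) by omega)
              (show 2 * p + 2 * q = 2 * A.dim by omega)
              (cupProduct (show 2 * a + 2 * b' = 2 * (p + B.dim) by omega) α
                (lefschetzInvolution hη.hasHardLefschetz
                  (show 2 * b + 2 * b' = 2 * (A.dim + B.dim) by omega) β))} =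
      algebraicClasses A.X p := by
  refine le_antisymm (Submodule.span_le.2 ?_) fun c hc ↦ ?_
  · rintro x ⟨B, μ, ν, -, hν, η, hη, a, b, b', q, hbb', hab, hq, α, β, hα, hβ, rfl⟩
    exact gysinMap_cupProduct_lefschetzInvolution_mem_algebraicClasses_abelianPiece A B μ ν hν hη hbb' hab hq hα hβ
  · by_cases hp : p ≤ A.dim
    · exact Submodule.subset_span (abelianPiece_of_mem_algebraicClasses A hp hc)
    · haveI := subsingleton_complexBetti (AbelianVariety.isSmoothProjective_holds (A := A))
        (show 2 * A.dim < 2 * p by omega)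
      rw [Subsingleton.elim c 0]
      exact Submodule.zero_mem _

/-! ## §3 Row b05 and `HC_AV` in the words of André's §6: abelian pieces versus all pieces -/

/-- **Row b05 ⟺ on complex abelian varieties, abelian pieces suffice**: `MotivatedImpliesAlgebraicAV` (every
motivated class — pieces ranging over ALL smooth projective varieties, André's §6.3 regime — on every complex
abelian variety is algebraic) holds iff every such class lies in the span of the generators with ABELIAN pieces
(André's §6.2 regime). By `span_abelianPieces_eq_algebraicClasses` the right-hand side is an unfolding of the
left; the theorem only records that row b05 IS the passage `𝒱 ⊇ {compact abelian pencils}` (where Thm. 0.6.2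
puts the Hodge classes) `→ 𝒱 = 𝒜b` (where motivated = algebraic). Nothing is discharged.
[cite: Andre1996Motifs, §6.2–6.3 (p. 31) and §6.3 Remarque 2 (p. 33)] -/
theorem motivatedImpliesAlgebraicAV_iff_motivatedClasses_le_span_abelianPieces :
    MotivatedImpliesAlgebraicAV ↔ ∀ (A : AbelianVariety ℂ) (p : ℕ), motivatedClasses A.dim A.X p ≤
      Submodule.span ℂ {x : complexBetti A.X (2 * p) | ∃ (B : AbelianVariety ℂ)
        (μ : HomologicalOrientation ℂ (ComplexPoints (A.X ⊗ B.X)) (2 * (A.dim + B.dim)))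
        (ν : HomologicalOrientation ℂ (ComplexPoints A.X) (2 * A.dim))
        (_ : μ.HasPoincareDuality) (_ : ν.HasPoincareDuality)
        (η : complexBetti (A.X ⊗ B.X) 2) (hη : IsPolarizationClass (A.dim + B.dim) (A.X ⊗ B.X) η)
        (a b b' q : ℕ) (_ : b + b' = A.dim + B.dim) (_ : a + b' = p + B.dim) (_ : p + q = A.dim)
        (α : complexBetti (A.X ⊗ B.X) (2 * a)) (β : complexBetti (A.X ⊗ B.X) (2 * b)),
        α ∈ algebraicClasses (A.X ⊗ B.X) a ∧ β ∈ algebraicClasses (A.X ⊗ B.X) b ∧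
          x = gysinMap μ ν (AlgPoints.mapContinuous (L := ℂ) (fst A.X B.X))
                (show 2 * (p + B.dim) + 2 * q = 2 * (A.dim + B.dim) by omega)
                (show 2 * p + 2 * q = 2 * A.dim by omega)
                (cupProduct (show 2 * a + 2 * b' = 2 * (p + B.dim) by omega) α
                  (lefschetzInvolution hη.hasHardLefschetz
                    (show 2 * b + 2 * b' = 2 * (A.dim + B.dim) by omega) β))} := by
  refine forall_congr' fun A ↦ forall_congr' fun p ↦ ?_
  rw [span_abelianPieces_eq_algebraicClasses A p]

/-- **`HC_AV` ⟺ André's Theorem 0.6.2 with `𝒱 = 𝒜b`**: the Hodge conjecture for complex abelian varieties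
(`Theses.PadicSemiregularLift.HodgeAbelianVarieties`) holds iff every rational class of Hodge type `(p, p)` on
every complex abelian variety `A` is a `ℂ`-combination of classes `pr_{A*}(α ∪ *_L β)`, `α`, `β` algebraic on
`A × B` with `B` an ABELIAN VARIETY. André proves exactly this with `B × Y₁ × ⋯ × Y_k` in place of `B`, `Yᵢ`
total spaces of compact pencils of abelian varieties (Thm. 0.6.2, the tree fact
`Andre1996_hodgeClasses_abelianVariety_motivated` in its `𝒱 = all` typing) — which is why, in his words, HC for
abelian varieties "se ramène" to `B` on the compact abelian pencils (§6.3 Remarque 2 = row b05's `X`). By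
`span_abelianPieces_eq_algebraicClasses` the right-hand side unfolds to "is algebraic": this is a READING of
`HC_AV`, not progress on it. [cite: Andre1996Motifs, Thm. 0.6.2 (p. 9), §6.2 (p. 31), §6.3 Remarque 2 (p. 33)] -/
theorem hc_av_iff_hodgeClasses_le_span_abelianPieces :
    Theses.PadicSemiregularLift.HodgeAbelianVarieties ↔
      ∀ (A : AbelianVariety ℂ) (p : ℕ) (c : complexBetti A.X (2 * p)),
        IsRationalClass c → IsOfHodgeType A.dim A.X (2 * p) p p c →
          c ∈ Submodule.span ℂ {x : complexBetti A.X (2 * p) | ∃ (B : AbelianVariety ℂ)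
            (μ : HomologicalOrientation ℂ (ComplexPoints (A.X ⊗ B.X)) (2 * (A.dim + B.dim)))
            (ν : HomologicalOrientation ℂ (ComplexPoints A.X) (2 * A.dim))
            (_ : μ.HasPoincareDuality) (_ : ν.HasPoincareDuality)
            (η : complexBetti (A.X ⊗ B.X) 2) (hη : IsPolarizationClass (A.dim + B.dim) (A.X ⊗ B.X) η)
            (a b b' q : ℕ) (_ : b + b' = A.dim + B.dim) (_ : a + b' = p + B.dim) (_ : p + q = A.dim)
            (α : complexBetti (A.X ⊗ B.X) (2 * a)) (β : complexBetti (A.X ⊗ B.X) (2 * b)),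
            α ∈ algebraicClasses (A.X ⊗ B.X) a ∧ β ∈ algebraicClasses (A.X ⊗ B.X) b ∧
              x = gysinMap μ ν (AlgPoints.mapContinuous (L := ℂ) (fst A.X B.X))
                    (show 2 * (p + B.dim) + 2 * q = 2 * (A.dim + B.dim) by omega)
                    (show 2 * p + 2 * q = 2 * A.dim by omega)
                    (cupProduct (show 2 * a + 2 * b' = 2 * (p + B.dim) by omega) α
                      (lefschetzInvolution hη.hasHardLefschetz
                        (show 2 * b + 2 * b' = 2 * (A.dim + B.dim) by omega) β))} := by
  refine forall_congr' fun A ↦ ?_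
  rw [hodgeConjectureFor_iff_of_isSmoothProjective nonempty_hodgeModel_holds
    (AbelianVariety.isSmoothProjective_holds (A := A))]
  refine forall_congr' fun p ↦ ?_
  rw [span_abelianPieces_eq_algebraicClasses A p]

/-! ## §4 The ladder edge (by name only): abelian pieces for Hodge classes would give `HC_CM` -/

/-- `HC_CM` (the stage-2 E-term `Theses.RankFourFaces.CMAbelianHodge`, by name, as a CONSEQUENCE): if Hodge
classes on complex abelian varieties are motivated by abelian pieces, then `HC_AV`
(`hc_av_iff_hodgeClasses_le_span_abelianPieces`) and hence `HC_CM` (`Ring2.Deform.HC_CM_of_HC_AV`). On this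
axis `HC_CM` is never an input. [cite: Andre1996Motifs, §6.2 (p. 31) and Thm. 0.6.2 (p. 9)] -/
theorem hc_cm_of_hodgeClasses_le_span_abelianPieces
    (h : ∀ (A : AbelianVariety ℂ) (p : ℕ) (c : complexBetti A.X (2 * p)),
      IsRationalClass c → IsOfHodgeType A.dim A.X (2 * p) p p c →
        c ∈ Submodule.span ℂ {x : complexBetti A.X (2 * p) | ∃ (B : AbelianVariety ℂ)
          (μ : HomologicalOrientation ℂ (ComplexPoints (A.X ⊗ B.X)) (2 * (A.dim + B.dim)))
          (ν : HomologicalOrientation ℂ (ComplexPoints A.X) (2 * A.dim))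
          (_ : μ.HasPoincareDuality) (_ : ν.HasPoincareDuality)
          (η : complexBetti (A.X ⊗ B.X) 2) (hη : IsPolarizationClass (A.dim + B.dim) (A.X ⊗ B.X) η)
          (a b b' q : ℕ) (_ : b + b' = A.dim + B.dim) (_ : a + b' = p + B.dim) (_ : p + q = A.dim)
          (α : complexBetti (A.X ⊗ B.X) (2 * a)) (β : complexBetti (A.X ⊗ B.X) (2 * b)),
          α ∈ algebraicClasses (A.X ⊗ B.X) a ∧ β ∈ algebraicClasses (A.X ⊗ B.X) b ∧
            x = gysinMap μ ν (AlgPoints.mapContinuous (L := ℂ) (fst A.X B.X))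
                  (show 2 * (p + B.dim) + 2 * q = 2 * (A.dim + B.dim) by omega)
                  (show 2 * p + 2 * q = 2 * A.dim by omega)
                  (cupProduct (show 2 * a + 2 * b' = 2 * (p + B.dim) by omega) α
                    (lefschetzInvolution hη.hasHardLefschetz
                      (show 2 * b + 2 * b' = 2 * (A.dim + B.dim) by omega) β))}) :
    Theses.RankFourFaces.CMAbelianHodge :=
  Ring2.Deform.HC_CM_of_HC_AV (hc_av_iff_hodgeClasses_le_span_abelianPieces.2 h)

/-! ## Audit: nothing is decided here

§1–§2 are hypothesis-free theorems about motivated generators (André §2.1 localised; §6.2 via Lieberman, a tree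
theorem); §3 are `↔`-readings of the OPEN row b05 / of `HC_AV`; §4 has the displayed hypothesis. Row b05 stays
OPEN «published modulo X». Axiom closures: the three standard axioms only. -/

#print axioms Summit.HodgeConjecture.HodgeConjecture.Ring2.Hypotheses.gysinMap_cupProduct_lefschetzInvolution_mem_algebraicClasses_abelianPiece
#print axioms Summit.HodgeConjecture.HodgeConjecture.Ring2.Hypotheses.span_abelianPieces_eq_algebraicClasses
#print axioms Summit.HodgeConjecture.HodgeConjecture.Ring2.Hypotheses.hc_av_iff_hodgeClasses_le_span_abelianPieces

end Summit.HodgeConjecture.HodgeConjecture.Ring2.Hypotheses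

end
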